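import Summits.ResolutionOfSingularities.ResolutionOfSingularities.Theorems.WeightedInvariantIota3JFlat
import HarnessLib

/-!
# (o70-w) THE WEIGHTS OF TWO σ-ATTAINING PRIMITIVE FLAGS AGREE
# (door `HypersurfaceCentreConstruction`, stmt-ResolutionOfSingularities-19897; clause h8 ⟸ (σ-pres)₃ ⟸ (o70-a) + (o70-b) + (o70-x);
# SPEC (Δ12) rev 2 `L/res-L1-w43-plan-1/JSigmaCanon_sketch.lean` aceffaa8e08fb006 of res-L1-w43-plan-1; hand res-D-brk-1)

Topic: `Summits/ResolutionOfSingularities/ResolutionOfSingularities/Theorems`. Helper for the door item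
`HypersurfaceCentreConstruction` (stmt-ResolutionOfSingularities-19897, route `WeightedInvariant`), line `local-engine`
(L W4.3), def-free.  The first, ring-generic brick of the registrar's (J-can) decomposition (DEAL 19:18:52Z → res-D-brk-1: (o70-w) + (o70-b)):

* `Iota3.sigmaWeights_unique` — (o70-w) = the body of `SigmaWeightsUniqueAt f` (SPEC (Δ12) l.56), at any order `ν`: two
  σ-maximisers `(g₁, g₂; q, r₁, r₂)`, `(g₁', g₂'; q', r₁', r₂')` of `f` (res-type-061's `IsSigmaMaximiser`, p529577) with PRIMITIVE weight
  triples have `(q', r₁', r₂') = (q, r₁, r₂)`: each lex condition applied to the other flag gives `r₁' r₂ = r₁ r₂'` and `r₁' q = r₁ q'`,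
  i.e. `r₁ · (q', r₁', r₂') = r₁' · (q, r₁, r₂)`, and two proportional primitive triples of positive integers are equal
  (`triple_eq_of_proportional`); `sigmaWeightsUniqueAt` is the spec's shape at `ν = ord f`.
((o70-x), the r.s.p. completion, is res-D-pv-048's by the dealer's RULING 19:20:07Z.)

[OURS · L1 W4.3 · (o70-w)]  Replaces the role of NO printed item; NOT a statement of the manuscript
[claim: Hironaka2017, status: under-review]. AI work, weaker than expert review.  Pure commutative algebra; no named facts.

## References

* H. Matsumura, *Commutative Ring Theory* (1987), Thm. 2.3 (Nakayama, minimal bases), Thm. 14.2. [Matsumura1987]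
* D. Abramovich, M. Temkin, J. Włodarczyk, *Functorial embedded resolution via weighted blowings up*, Algebra & Number Theory 18
  (2024), §5 (the invariant and its normalised weights). [AbramovichTemkinWlodarczyk2024]
-/

noncomputable section

set_option linter.dupNamespace false -- mandated namespace `Summit.<Summit>.<Problem>` of this single-conjunct summit

open IsLocalRing Literature.AlgebraicGeometry.Resolution
open Summit.ResolutionOfSingularities.ResolutionOfSingularities.Theorems

namespace Summit.ResolutionOfSingularities.ResolutionOfSingularities.Cruxes.HypersurfaceCentreConstruction.LocalEngine

namespace Iota3

/-! ## (o70-w) Proportional primitive triples are equal -/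

/-- If `a, b` are coprime and `b · u = a · v` then `a ∣ u`. [folklore] -/
theorem dvd_of_coprime_of_mul_eq {a b u v : ℕ} (hab : Nat.Coprime a b) (h : b * u = a * v) : a ∣ u :=
  hab.dvd_of_dvd_mul_left ⟨v, by rw [h]⟩

/-- **Two proportional primitive triples of naturals with positive pivots are equal**: `r₁' q = r₁ q'`, `r₁' r₂ = r₁ r₂'`, `r₁, r₁' > 0`,
both triples primitive ⇒ `(q', r₁', r₂') = (q, r₁, r₂)`. [folklore] -/
theorem triple_eq_of_proportional {q r₁ r₂ q' r₁' r₂' : ℕ} (hr₁ : 0 < r₁) (hr₁' : 0 < r₁')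
    (hq : r₁' * q = r₁ * q') (hr : r₁' * r₂ = r₁ * r₂')
    (hp : IsPrimitiveTriple q r₁ r₂) (hp' : IsPrimitiveTriple q' r₁' r₂') : q' = q ∧ r₁' = r₁ ∧ r₂' = r₂ := by
  -- write `r₁ = a g`, `r₁' = b g` with `a, b` coprime
  obtain ⟨a, b, hab, ha, hb⟩ := Nat.exists_coprime r₁ r₁'
  obtain ⟨g, hg⟩ : ∃ g : ℕ, Nat.gcd r₁ r₁' = g := ⟨_, rfl⟩
  rw [hg] at ha hb
  subst ha hb
  have hg0 : 0 < g := Nat.pos_of_mul_pos_left hr₁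
  -- `b q = a q'`, `b r₂ = a r₂'`
  have hq' : b * q = a * q' := by
    rw [mul_right_comm b g q, mul_right_comm a g q'] at hq
    exact Nat.eq_of_mul_eq_mul_right hg0 hq
  have hr' : b * r₂ = a * r₂' := by
    rw [mul_right_comm b g r₂, mul_right_comm a g r₂'] at hr
    exact Nat.eq_of_mul_eq_mul_right hg0 hr
  -- `a` divides `q, r₁, r₂`, so `a = 1`; `b` divides `q', r₁', r₂'`, so `b = 1`
  have ha1 : a = 1 := hp a (dvd_of_coprime_of_mul_eq hab hq') ⟨g, rfl⟩ (dvd_of_coprime_of_mul_eq hab hr')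
  have hb1 : b = 1 := hp' b (dvd_of_coprime_of_mul_eq hab.symm hq'.symm) ⟨g, rfl⟩
    (dvd_of_coprime_of_mul_eq hab.symm hr'.symm)
  subst ha1 hb1
  rw [one_mul] at hq hr ⊢
  exact ⟨(Nat.eq_of_mul_eq_mul_left hg0 hq).symm, rfl, (Nat.eq_of_mul_eq_mul_left hg0 hr).symm⟩

/-- **(o70-w) THE WEIGHTS OF TWO σ-MAXIMISERS WITH PRIMITIVE TRIPLES AGREE** (any local ring, any order `ν`): the two lex conditions
applied crosswise give `r₁' r₂ = r₁ r₂'` and `r₁' q = r₁ q'`, and proportional primitive triples are equal.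
[OURS · L1 W4.3 · (o70-w)] -/
theorem sigmaWeights_unique {S : Type} [CommRing S] [IsLocalRing S] {f : S} {ν : ℕ}
    {g₁ g₂ : S} {q r₁ r₂ : ℕ} {g₁' g₂' : S} {q' r₁' r₂' : ℕ}
    (h : IsSigmaMaximiser f ν g₁ g₂ q r₁ r₂) (hp : IsPrimitiveTriple q r₁ r₂)
    (h' : IsSigmaMaximiser f ν g₁' g₂' q' r₁' r₂') (hp' : IsPrimitiveTriple q' r₁' r₂') :
    q' = q ∧ r₁' = r₁ ∧ r₂' = r₂ := by
  have h1 := h.2.2.2 q' r₁' r₂' h'.1 h'.flagReaches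
  have h2 := h'.2.2.2 q r₁ r₂ h.1 h.flagReaches
  have hr : r₁' * r₂ = r₁ * r₂' := by
    rcases h1 with h1 | h1 <;> rcases h2 with h2 | h2 <;> omega
  have hq : r₁' * q = r₁ * q' := by
    rcases h1 with h1 | ⟨-, h1⟩
    · omega
    rcases h2 with h2 | ⟨-, h2⟩
    · omega
    exact le_antisymm h1 (by linarith)
  exact triple_eq_of_proportional h.1.pos.2.2 h'.1.pos.2.2 hq hr hp hp'

/-- (o70-w) in the spec's shape (`SigmaWeightsUniqueAt f`, SPEC (Δ12) l.56: at the order `ν = ord f`). [OURS · L1 W4.3 · (o70-w)] -/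
theorem sigmaWeightsUniqueAt {S : Type} [CommRing S] [IsLocalRing S] (f : S) :
    ∀ (g₁ g₂ : S) (q r₁ r₂ : ℕ) (g₁' g₂' : S) (q' r₁' r₂' : ℕ),
      IsSigmaMaximiser f (adicOrder f).toNat g₁ g₂ q r₁ r₂ → IsPrimitiveTriple q r₁ r₂ →
      IsSigmaMaximiser f (adicOrder f).toNat g₁' g₂' q' r₁' r₂' → IsPrimitiveTriple q' r₁' r₂' →
      q' = q ∧ r₁' = r₁ ∧ r₂' = r₂ :=
  fun _ _ _ _ _ _ _ _ _ _ h hp h' hp' => sigmaWeights_unique h hp h' hp'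

end Iota3

end Summit.ResolutionOfSingularities.ResolutionOfSingularities.Cruxes.HypersurfaceCentreConstruction.LocalEngine

end
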